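import Summits.SmoothPoincare4.SmoothPoincare4.Theses.CongruenceShadows
import Literature.Topology.FourManifolds.StandardTrisectionSlotSymmetry
import Summits.SmoothPoincare4.SmoothPoincare4.Theorems.AgkCor6Sufficiency.Negative.AnyGroupFalse
import Summits.SmoothPoincare4.SmoothPoincare4.Theorems.AgkCor6Sufficiency.Negative.StablyTrivialTight
import Summits.SmoothPoincare4.SmoothPoincare4.Theorems.WaldhausenPairs.Negative.PairTransferFalse
import Summits.SmoothPoincare4.SmoothPoincare4.Theorems.WaldhausenPairs.Negative.StandardPairSymmetries
import Summits.SmoothPoincare4.SmoothPoincare4.Theorems.WaldhausenPairs.Negative.LoadBearing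
import Literature.Topology.FourManifolds.TrisectionFunctorSPC4Proofs
import Summits.SmoothPoincare4.SmoothPoincare4.Theorems.AgkCor6Sufficiency.Negative.DownwardClosed

/-!
# Disproof of `NormalFormStablyTrivial` (stmt-SmoothPoincare4-14591) — standing disprover's work file

Crux (target of route `CongruenceShadows`, rank 0; auto-crux since 2026-08-16T04:17Z):

  NormalFormStablyTrivial := ∀ m (K : TrisectionKernels (3+3m)),
    IsGroupTrisection (3+3m) (m+1) PUnit K → PairsStandard m K → K.IsStablyTrivial,
  PairsStandard m K := ∀ i ≠ j, ∃ α ∈ Aut S_{3+3m}, α(N i) = K i ∧ α(N j) = K j,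
  N := s4Kernels.stabilizeIter m  (the standard `(3+3m; m+1)` trisection of `S⁴`).

VERDICT (cycle 1, 2026-08-16): NO KILL — and none is possible short of an exotic `S⁴`.  Everything
below is PROVED (`lean check` rc 0, no `sorry`, axioms `propext / Classical.choice / Quot.sound`);
prose only in docstrings.  Findings, indexed by section:

* **§1 Read-back / standard model.**  The decl elaborates and is literally
  `∀ m K, IsGroupTrisection … → PairsStandard m K → K.IsStablyTrivial` (`normalFormStablyTrivial_iff`,
  `Iff.rfl`).  No coercions, no junk operators; `N` has genus `3+3m` definitionally; `Aut = Mod±`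
  (Dehn–Nielsen–Baer) in hypothesis AND conclusion, which only weakens both consistently.  At every
  `m` the standard triple satisfies both hypotheses (`α = 1`) and the conclusion with `n = 0`
  (`standard_model`): not vacuous, not refutable inside the standard family, bound attained.
* **§2 Which hypotheses carry weight.**  Under `PairsStandard` the fields `normal`,
  `free_quotient`, `free_pairQuotient` of `IsGroupTrisection` are DECORATION (each slot / pair is an
  automorphic image of a standard slot / pair: `normal_of_pairsStandard`,
  `free_quotient_of_pairsStandard`, `free_pairQuotient_of_pairsStandard`); a normal form is a
  `(3+3m, m+1)` group trisection OF ITS OWN TRIPLE QUOTIENT (`isGroupTrisection_of_pairsStandard`).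
  Hence `normalFormStablyTrivial_iff_tripleForm`: **crux ⇔ ∀ m K, π₁ = 1 (triple quotient
  trivial) → PairsStandard m K → stably trivial.**  A proof can draw strength only from `π₁ = 1`
  and from the INTERACTION of the three pair automorphisms `α₀₁, α₀₂, α₁₂`.
* **§3 LOAD-BEARING `triple` (main new theorem).**  `normalFormStablyTrivial_false_without_triple`:
  dropping `π₁ = 1` (equivalently: allowing any group `G`, `NormalFormStablyTrivialAnyGroup`; or
  dropping the whole `IsGroupTrisection` hypothesis, `NormalFormStablyTrivialWithoutHyp`) makes the
  crux FALSE.  Witness: `m = 0` and the `(3;1,1,1)` trisection `zKernels = (⟪a₀,a₁,a₂⟫, ⟪a₀,b₁,b₂⟫,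
  ⟪a₀,a₁b₁,a₂b₂⟫)` of `S¹×S³ # ℂP² # ℂP²` (`χ = 2`, `π₁ = ℤ`; sibling file
  `AgkCor6Sufficiency/Negative/AnyGroupFalse.lean`): it IS in Waldhausen normal form —
  `pairs_zKernels`, three explicit relator-fixing automorphisms of `S_3` (half-twist `ρ₂`, Dehn
  twists `T_{a₁}`, `T_{a₂}ρ₂`, `ρ₁T_{a₁}⁻¹`, `T_{b₂}`, all identities by `decide` in `F_6`) composed
  with the slot symmetries `cyc`, `swp` of `StandardTrisectionSlotSymmetry.lean` — but it is not
  stably trivial (`π₁ ≠ 1` survives stabilisation, `isStablyTrivial_tight`).  So ANY proof must use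
  simple connectivity of the triple quotient; within normal forms `π₁` is the only cheap
  obstruction (`not_isStablyTrivial_of_pairsStandard_of_nontrivial`) and the crux says it is the
  only one, stably.  Geometrically: pairwise-standard Heegaard pairs do not see `π₁(X)`.
* **§4 The gate form and the Nielsen gap.**  `gateForm_of_normalFormStablyTrivial`: the crux
  implies its `(0,1)`-NORMALISED form `GateForm` — triples `(N₀, N₁, K₂)` with `π₁ = 1`,
  `K₂ = β N₂ = γ N₂` for some `β ∈ Stab N₀`, `γ ∈ Stab N₁` (the card's gate `AC ∩ BC`) are stably
  trivial; conversely `normalFormStablyTrivial_of_gateForm`: `GateForm` + `IsoInvariant` (stable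
  triviality is invariant under `Iso`, i.e. under re-marking by ALL of `Aut S_g`) ⇒ crux.
  `IsoInvariant` is true on paper (Nielsen 1927: every automorphism of `S_g` lifts to `F_{2g}`
  fixing the relator up to conjugacy/inversion; then `iso_stabilize_map_of_lift`,
  TrisectionFunctorGKStabilization.lean) but NOT in tree unconditionally — the same gap recorded
  for the sibling crux (`AgkCor6Sufficiency/Disproof.lean` §10, `LevelStabilizeOneRemarking.lean`).
  PROVER WARNING: "WLOG `(K₀,K₁) = (N₀,N₁)`" costs exactly Nielsen; `isoInvariant_of_nielsen` /
  `normalFormStablyTrivial_iff_gate_of_nielsen` derive `IsoInvariant` and `crux ↔ GateForm` from the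
  tree's registered Nielsen hypothesis `hN` (shape of `TrisectionKernels.Iso.stabilizeIter_of_liftable`).
* **§5 Refuted / open strengthenings (pointers).**  (i) "an `α` standardising the pair `(K₀,K₁)`
  also standardises `K₂`" — FALSE at `K = N`, `m = 0` (Dehn twist about the shared curve;
  sibling `WaldhausenPairs/Negative/StandardPairSymmetries.lean`, `not_pairsDetermineThird`,
  re-exported here as `not_pairsDetermineThird'`); (ii) "the three `α_{ij}` can be chosen equal" =
  `Iso N K` unstably = `SPC4_g ∧` 4-d Waldhausen at genus `g` (Meier–Schirmer–Zupan Conj. 3.11,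
  believed false for `S⁴` itself at large genus) — no finite model, not attackable here;
  (iii) any-group / no-`π₁` versions — FALSE (§3); (iv) the `m = 0` slice alone ("every
  `(3;1,1,1)`-trisected homotopy 4-sphere is stably standard") is OPEN in print: `(3;1,1,1)` is the
  first balanced type outside Meier–Zupan (g ≤ 2) / Meier–Schirmer–Zupan (kᵢ ≥ g-1); it is Meier's
  Conjecture 1.2 (MRL 25 (2018)) restricted to homotopy spheres, PROVED for WEAKLY REDUCIBLE
  genus-3 trisections and for those with a DEPENDENT TRIPLE by Aranda–Zupan 2025
  (arXiv:2503.04607, Thm 1.3 / Thm 1.4 / Cor 1.5: simply connected + such a genus-3 trisection ⇒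
  `S⁴` or sums of `±ℂP²`, `S²×S²`; read pp. 1–2) — weak reducibility is a condition on disjoint
  simple closed curves, not expressible on kernel triples alone, so this is a pointer for the
  prover of the `m = 0` rung, not a lemma here.
* **§6 The gate needs BOTH sides (second new theorem family).**  `not_isStablyTrivial_of_pairRank`:
  pair ranks are stable invariants (pair quotients of stabilisations are free products with `F_1`),
  so a genus-`3+3m` triple with a pair quotient of rank `≠ m+1` is never stably trivial — the pair
  conditions of the normal form carry exactly balancedness.  `gate_false_without_gamma` /
  `gate_false_without_beta`: with `(K₀,K₁) = (N₀,N₁)` and `π₁ = 1`, `K₂ ∈ Stab(N₀)·N₂` ALONE (resp.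
  `K₂ ∈ Stab(N₁)·N₂` alone) does not give stable triviality — `K₂ = T_{b₂}N₂` (resp. `T_{b₁}N₂`),
  Dehn twist about a curve bounding in `H₀` (resp. `H₁`), yields the UNBALANCED `(3;1,1,0)` (resp.
  `(3;1,0,1)`) trisection of `ℂP²`: simply connected, pair rank `0 ≠ 1`.  Equivalently
  `tripleForm_false_without_pair12 / 02 / 01`: in the triple form EACH of the three pair conditions
  is load-bearing (third witness `(N₀, T_{b₀}N₁, N₂)`).  Card language: `A·C` and `B·C` each contain
  `ℂP²`; only `AC ∩ BC` can be `(A∩B)·C` stably.  Complete load-bearing table of the triple form: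
  `π₁ = 1` (§3), pair01, pair02, pair12 (§6) — all four load-bearing, nothing else in the statement.
* **§7 Level descent modulo Nielsen.**  `level_down_of_nielsen`: granted `hN`, the crux at level
  `m+1` implies it at level `m` (one stabilisation: `IsGroupTrisection` and `PairsStandard` ascend —
  the latter by `iso_stabilize_map_of_lift` — and stable triviality descends); hence
  `normalFormStablyTrivial_of_eventually_of_nielsen`: the EVENTUAL form (`∀ m ≥ m₀`) already gives
  the crux.  Provers may work in the asymptotic regime `g = 3+3m ≫ 0` (Dunfield–Thurston, rung
  `ShadowsStandard`); refuters gain nothing from small `m` unless the witness persists stably.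
* **Why it resists.**  On paper `PairsStandard` is a THEOREM for every group trisection of `{1}`
  (crux `WaldhausenPairs`: Leininger–Reid/Jaco + Kneser–Stallings–Perelman + Waldhausen 1968 +
  DNB), so crux ⇔ AGK's condition `X` at types `(3k,k)`, `k ≥ 1` ⇔ SPC4 (Abrams–Gay–Kirby 2018
  Cor. 6; the `k = 0` slice is trivial).  A Lean refutation = a pairwise-standard `(3+3m;m+1)`
  triple with `π₁ = 1` that is never simultaneously standard after stabilisation = an exotic `S⁴`
  through AGK Thm 5 + Gay–Kirby stable uniqueness; the normal form costs nothing and gives nothing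
  refutable.  No junk model: `PairsStandard` pins every `K i` to an automorphic image of `N i`
  (§2), `π₁ = 1` excludes the `S¹×S³`-summand family (§3), and orientation/slot conventions are
  absorbed by `Aut = Mod±` and the `S₃` slot symmetry of `N`.
* **Targets:** none (payload `stuck_stubs = []`, no line picked); stub kills go to `-- Targets`
  below §5 on re-arm.  **Near-misses:** none stated with `sorry`.

References: A. Abrams, D. Gay, R. Kirby, *Group trisections and smooth 4-manifolds*, Geom. Topol.
22 (2018) 1537–1545, Def. 1–3, Thm. 5, Cor. 6; D. Gay, R. Kirby, *Trisecting 4-manifolds*, Geom.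
Topol. 20 (2016), §2 (genus-one trisections of `S¹×S³`, `ℂP²`; connected sum; stabilisation);
F. Waldhausen, *Heegaard-Zerlegungen der 3-Sphäre*, Topology 7 (1968); J. Nielsen, Acta Math. 50
(1927); J. Meier, T. Schirmer, A. Zupan, *Classification of trisections and the generalized
property R conjecture*, PAMS 144 (2016), Conj. 3.11; J. Meier, A. Zupan, *Genus-two trisections are
standard*, Geom. Topol. 21 (2017); J. Meier, *Trisections and spun four-manifolds*, Math. Res.
Lett. 25 (2018) (Conj. 1.2 of the next item); R. Aranda, A. Zupan, *Manifolds with weakly reducible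
genus-three trisections are standard*, arXiv:2503.04607 (2025), Thm 1.3, Thm 1.4, Cor 1.5.
-/

set_option linter.dupNamespace false

noncomputable section

namespace Summit.SmoothPoincare4.SmoothPoincare4.Cruxes.NormalFormStablyTrivial.Disproof

open Literature.Topology.FourManifolds Subgroup RelatorAut
open Summit.SmoothPoincare4.SmoothPoincare4.Theses.CongruenceShadows (NormalFormStablyTrivial WaldhausenPairs)
open Summit.SmoothPoincare4.SmoothPoincare4.Theorems.AgkCor6Sufficiency.Negative
  (za zb zKernels zKernels_zero zKernels_one zKernels_two zKernels_isGroupTrisection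
   not_isStablyTrivial_zKernels not_subsingleton_tripleQuotient_zKernels isStablyTrivial_tight
   isStablyTrivial_s4Kernels_stabilizeIter Iso.nonempty_tripleQuotient_equiv
   isGroupTrisection_cast Iso.nonempty_pairQuotient_equiv subsingleton_quotient_of_forall_of_mem
   isStablyTrivial_of_stabilizeIter)
open Summit.SmoothPoincare4.SmoothPoincare4.Theorems.WaldhausenPairs.Negative
  (stabilizeIter_isGroupTrisection IsGroupTrisection.map_mulEquiv not_pairsDetermineThird
   IsFreeOfRank.rank_eq)

variable {m : ℕ}

/-! ## §1 Read-back, the standard model, non-vacuity -/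

/-- The normal-form hypothesis of the crux: every ordered pair of kernels is the image of the
corresponding standard pair under ONE automorphism of `S_{3+3m}`. [folklore] -/
def PairsStandard (m : ℕ) (K : TrisectionKernels (3 + 3 * m)) : Prop :=
  ∀ i j : Fin 3, i ≠ j → ∃ α : SurfaceGroup (3 + 3 * m) ≃* SurfaceGroup (3 + 3 * m),
    (s4Kernels.stabilizeIter m i).map α.toMonoidHom = K i ∧
    (s4Kernels.stabilizeIter m j).map α.toMonoidHom = K j

/-- READ-BACK: the crux is literally `∀ m K, IsGroupTrisection (3+3m) (m+1) 1 K →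
PairsStandard m K → K.IsStablyTrivial`. [folklore] -/
theorem normalFormStablyTrivial_iff :
    NormalFormStablyTrivial ↔ ∀ (m : ℕ) (K : TrisectionKernels (3 + 3 * m)),
      IsGroupTrisection (3 + 3 * m) (m + 1) (PUnit : Type) K → PairsStandard m K →
        K.IsStablyTrivial :=
  Iff.rfl

/-- The standard triple is in normal form (`α = 1`). [folklore] -/
theorem pairsStandard_std (m : ℕ) : PairsStandard m (s4Kernels.stabilizeIter m) :=
  fun _ _ _ => ⟨MulEquiv.refl _, by simp, by simp⟩

/-- NON-VACUITY / TIGHTNESS AT THE STANDARD MODEL: at every `m` the standard triple satisfies both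
hypotheses and the conclusion (with `n = 0` stabilisations). [folklore] -/
theorem standard_model (m : ℕ) :
    IsGroupTrisection (3 + 3 * m) (m + 1) (PUnit : Type) (s4Kernels.stabilizeIter m) ∧
      PairsStandard m (s4Kernels.stabilizeIter m) ∧ (s4Kernels.stabilizeIter m).IsStablyTrivial :=
  ⟨stabilizeIter_isGroupTrisection m, pairsStandard_std m, isStablyTrivial_s4Kernels_stabilizeIter m⟩

/-! ## §2 Which hypotheses carry weight: `normal`, `free_quotient`, `free_pairQuotient` are
DECORATION under `PairsStandard`; only `triple` (π₁ = 1) is independent -/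

/-- Each slot of a normal form is individually standard. [folklore] -/
theorem exists_slot_of_pairsStandard {K : TrisectionKernels (3 + 3 * m)} (h : PairsStandard m K)
    (i : Fin 3) : ∃ α : SurfaceGroup (3 + 3 * m) ≃* SurfaceGroup (3 + 3 * m),
      (s4Kernels.stabilizeIter m i).map α.toMonoidHom = K i := by
  obtain ⟨j, hj⟩ : ∃ j : Fin 3, i ≠ j := by
    fin_cases i
    · exact ⟨1, by decide⟩
    · exact ⟨0, by decide⟩
    · exact ⟨0, by decide⟩
  obtain ⟨α, hi, -⟩ := h i j hj
  exact ⟨α, hi⟩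

/-- `normal` is implied by the normal form. [folklore] -/
theorem normal_of_pairsStandard {K : TrisectionKernels (3 + 3 * m)} (h : PairsStandard m K)
    (i : Fin 3) : (K i).Normal := by
  obtain ⟨α, hα⟩ := exists_slot_of_pairsStandard h i
  rw [← hα]
  exact ((stabilizeIter_isGroupTrisection m).normal i).map _ α.surjective

/-- `free_quotient` (`S/Kᵢ ≅ F_{3+3m}`) is implied by the normal form. [folklore] -/
theorem free_quotient_of_pairsStandard {K : TrisectionKernels (3 + 3 * m)} (h : PairsStandard m K)
    (i : Fin 3) :
    IsFreeOfRank (SurfaceGroup (3 + 3 * m) ⧸ normalClosure (K i : Set (SurfaceGroup (3 + 3 * m))))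
      (3 + 3 * m) := by
  obtain ⟨α, hα⟩ := exists_slot_of_pairsStandard h i
  have key := (IsGroupTrisection.map_mulEquiv (stabilizeIter_isGroupTrisection m) α).free_quotient i
  rwa [hα] at key

/-- `free_pairQuotient` (`S/⟪Kᵢ ∪ Kⱼ⟫ ≅ F_{m+1}`) is implied by the normal form. [folklore] -/
theorem free_pairQuotient_of_pairsStandard {K : TrisectionKernels (3 + 3 * m)}
    (h : PairsStandard m K) (i j : Fin 3) (hij : i ≠ j) :
    IsFreeOfRank (K.pairQuotient i j) (m + 1) := by
  obtain ⟨α, hi, hj⟩ := h i j hij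
  have key := (IsGroupTrisection.map_mulEquiv (stabilizeIter_isGroupTrisection m) α).free_pairQuotient i j hij
  dsimp only [TrisectionKernels.pairQuotient] at key ⊢
  rwa [hi, hj] at key

/-- A normal form is a `(3+3m, m+1)` group trisection OF ITS OWN TRIPLE QUOTIENT (and of any
group isomorphic to it): the three structural fields come for free. [folklore] -/
theorem isGroupTrisection_of_pairsStandard {K : TrisectionKernels (3 + 3 * m)}
    (h : PairsStandard m K) {G : Type*} [Group G] (e : Nonempty (K.tripleQuotient ≃* G)) :
    IsGroupTrisection (3 + 3 * m) (m + 1) G K :=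
  ⟨normal_of_pairsStandard h, free_quotient_of_pairsStandard h,
    free_pairQuotient_of_pairsStandard h, e⟩

/-- TRIPLE FORM of the crux: only simple connectivity of the triple quotient and the normal form
are hypotheses. [folklore] -/
def TripleForm : Prop :=
  ∀ (m : ℕ) (K : TrisectionKernels (3 + 3 * m)),
    Subsingleton K.tripleQuotient → PairsStandard m K → K.IsStablyTrivial

/-- **The crux is equivalent to its triple form**: `IsGroupTrisection (3+3m) (m+1) 1 K` may be
replaced by `π₁ = 1` (the triple quotient is trivial); `normal`, `free_quotient`,
`free_pairQuotient` are consequences of `PairsStandard`. Information for the prover: those three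
fields cannot be where a proof draws strength. [folklore] -/
theorem normalFormStablyTrivial_iff_tripleForm : NormalFormStablyTrivial ↔ TripleForm := by
  constructor
  · intro h m K hs hP
    letI : Unique K.tripleQuotient := @uniqueOfSubsingleton _ hs 1
    exact h m K (isGroupTrisection_of_pairsStandard hP ⟨MulEquiv.ofUnique⟩) hP
  · intro h m K hK hP
    obtain ⟨e⟩ := hK.triple
    exact h m K e.toEquiv.subsingleton hP

/-- Within normal forms, `π₁` obstructs stable triviality: a normal form with non-trivial triple
quotient is never stably trivial (it is a group trisection of its triple quotient, and stable
triviality forces that group to be trivial — `isStablyTrivial_tight`). So `triple` excludes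
exactly the one cheap obstruction; the crux asserts there is no other, stably. [folklore] -/
theorem not_isStablyTrivial_of_pairsStandard_of_nontrivial {K : TrisectionKernels (3 + 3 * m)}
    (h : PairsStandard m K) (hnt : Nontrivial K.tripleQuotient) : ¬ K.IsStablyTrivial := by
  intro hst
  obtain ⟨-, ⟨e⟩⟩ := isStablyTrivial_tight (isGroupTrisection_of_pairsStandard h ⟨MulEquiv.refl _⟩) hst
  exact not_subsingleton K.tripleQuotient e.toEquiv.subsingleton

/-! ## §3 LOAD-BEARING `triple`: the normal form `zKernels` of `S¹×S³ # ℂP² # ℂP²` -/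

/-! ### Three relator-fixing LOCAL automorphisms of `S_3` (products of half-twists and Dehn
twists on handles 1, 2; handle 0 fixed) -/

/-- `ρ₂` (half-twist on handle 2): `a₂ ↦ b₂⁻¹`, `b₂ ↦ b₂ a₂ b₂⁻¹`. [folklore] -/
def rot2Gen (x : surfaceGen 3) : FreeGroup (surfaceGen 3) :=
  if x = (2, false) then (FreeGroup.of (2, true))⁻¹
  else if x = (2, true) then FreeGroup.of (2, true) * FreeGroup.of (2, false) * (FreeGroup.of (2, true))⁻¹
  else FreeGroup.of x

/-- `ρ₂⁻¹`: `a₂ ↦ a₂ b₂ a₂⁻¹`, `b₂ ↦ a₂⁻¹`. [folklore] -/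
def rot2InvGen (x : surfaceGen 3) : FreeGroup (surfaceGen 3) :=
  if x = (2, false) then FreeGroup.of (2, false) * FreeGroup.of (2, true) * (FreeGroup.of (2, false))⁻¹
  else if x = (2, true) then (FreeGroup.of (2, false))⁻¹
  else FreeGroup.of x

/-- `ρ₂` as a relator-fixing automorphism (all identities by `decide` in the free group).
[folklore] -/
def rot2 : RelatorAut 3 :=
  ofGens rot2Gen rot2InvGen (by decide) (by decide) (by decide) (by decide)

/-- `θ` = (`T_{a₁}` on handle 1: `b₁ ↦ b₁ a₁`) · (`T_{a₂} ρ₂` on handle 2: `a₂ ↦ a₂⁻¹ b₂⁻¹`,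
`b₂ ↦ b₂ a₂ b₂⁻¹`). [folklore] -/
def aut02Gen (x : surfaceGen 3) : FreeGroup (surfaceGen 3) :=
  if x = (1, true) then FreeGroup.of (1, true) * FreeGroup.of (1, false)
  else if x = (2, false) then (FreeGroup.of (2, false))⁻¹ * (FreeGroup.of (2, true))⁻¹
  else if x = (2, true) then FreeGroup.of (2, true) * FreeGroup.of (2, false) * (FreeGroup.of (2, true))⁻¹
  else FreeGroup.of x

/-- `θ⁻¹`: `b₁ ↦ b₁ a₁⁻¹`, `a₂ ↦ a₂ b₂ a₂⁻¹`, `b₂ ↦ b₂⁻¹ a₂⁻¹`. [folklore] -/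
def aut02InvGen (x : surfaceGen 3) : FreeGroup (surfaceGen 3) :=
  if x = (1, true) then FreeGroup.of (1, true) * (FreeGroup.of (1, false))⁻¹
  else if x = (2, false) then FreeGroup.of (2, false) * FreeGroup.of (2, true) * (FreeGroup.of (2, false))⁻¹
  else if x = (2, true) then (FreeGroup.of (2, true))⁻¹ * (FreeGroup.of (2, false))⁻¹
  else FreeGroup.of x

/-- `θ` as a relator-fixing automorphism. [folklore] -/
def aut02 : RelatorAut 3 :=
  ofGens aut02Gen aut02InvGen (by decide) (by decide) (by decide) (by decide)

/-- `λ` = (`ρ₁ T_{a₁}⁻¹` on handle 1: `a₁ ↦ b₁⁻¹`, `b₁ ↦ b₁ a₁`) · (`T_{b₂}` on handle 2: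
`a₂ ↦ a₂ b₂`). [folklore] -/
def aut12Gen (x : surfaceGen 3) : FreeGroup (surfaceGen 3) :=
  if x = (1, false) then (FreeGroup.of (1, true))⁻¹
  else if x = (1, true) then FreeGroup.of (1, true) * FreeGroup.of (1, false)
  else if x = (2, false) then FreeGroup.of (2, false) * FreeGroup.of (2, true)
  else FreeGroup.of x

/-- `λ⁻¹`: `a₁ ↦ a₁ b₁`, `b₁ ↦ a₁⁻¹`, `a₂ ↦ a₂ b₂⁻¹`. [folklore] -/
def aut12InvGen (x : surfaceGen 3) : FreeGroup (surfaceGen 3) :=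
  if x = (1, false) then FreeGroup.of (1, false) * FreeGroup.of (1, true)
  else if x = (1, true) then (FreeGroup.of (1, false))⁻¹
  else if x = (2, false) then FreeGroup.of (2, false) * (FreeGroup.of (2, true))⁻¹
  else FreeGroup.of x

/-- `λ` as a relator-fixing automorphism. [folklore] -/
def aut12 : RelatorAut 3 :=
  ofGens aut12Gen aut12InvGen (by decide) (by decide) (by decide) (by decide)

/-- `ofGens` automorphisms on generators. [folklore] -/
theorem ofGens_of (f finv : surfaceGen 3 → FreeGroup (surfaceGen 3)) (h1 h2 h3 h4) (x : surfaceGen 3) :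
    (ofGens f finv h1 h2 h3 h4).toMulEquiv (PresentedGroup.of x) = PresentedGroup.mk _ (f x) := by
  change (ofGens f finv h1 h2 h3 h4).toMulEquiv (PresentedGroup.mk _ (FreeGroup.of x)) = _
  rw [toMulEquiv_mk]
  simp [ofGens]

/-- `ofGens` inverses on generators. [folklore] -/
theorem ofGens_symm_of (f finv : surfaceGen 3 → FreeGroup (surfaceGen 3)) (h1 h2 h3 h4)
    (x : surfaceGen 3) :
    (ofGens f finv h1 h2 h3 h4).toMulEquiv.symm (PresentedGroup.of x) = PresentedGroup.mk _ (finv x) := by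
  change (ofGens f finv h1 h2 h3 h4).toMulEquiv.symm (PresentedGroup.mk _ (FreeGroup.of x)) = _
  rw [toMulEquiv_symm_mk]
  simp [ofGens]

-- generator values (everything as `za i = of (i,false)`, `zb i = of (i,true)`)
theorem rot2_za0 : rot2.toMulEquiv (za 0) = za 0 := by
  rw [rot2, ofGens_of]; simp [rot2Gen, PresentedGroup.of]
theorem rot2_za1 : rot2.toMulEquiv (za 1) = za 1 := by
  rw [rot2, ofGens_of]; simp [rot2Gen, PresentedGroup.of]
theorem rot2_zb1 : rot2.toMulEquiv (zb 1) = zb 1 := by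
  rw [rot2, ofGens_of]; simp [rot2Gen, PresentedGroup.of]
theorem rot2_za2 : rot2.toMulEquiv (za 2) = (zb 2)⁻¹ := by
  rw [rot2, ofGens_of]; simp [rot2Gen, PresentedGroup.of]
theorem rot2_zb2 : rot2.toMulEquiv (zb 2) = zb 2 * za 2 * (zb 2)⁻¹ := by
  rw [rot2, ofGens_of]; simp [rot2Gen, PresentedGroup.of, mul_assoc]
theorem rot2_symm_za0 : rot2.toMulEquiv.symm (za 0) = za 0 := by
  rw [rot2, ofGens_symm_of]; simp [rot2InvGen, PresentedGroup.of]
theorem rot2_symm_za1 : rot2.toMulEquiv.symm (za 1) = za 1 := by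
  rw [rot2, ofGens_symm_of]; simp [rot2InvGen, PresentedGroup.of]
theorem rot2_symm_zb1 : rot2.toMulEquiv.symm (zb 1) = zb 1 := by
  rw [rot2, ofGens_symm_of]; simp [rot2InvGen, PresentedGroup.of]
theorem rot2_symm_za2 : rot2.toMulEquiv.symm (za 2) = za 2 * zb 2 * (za 2)⁻¹ := by
  rw [rot2, ofGens_symm_of]; simp [rot2InvGen, PresentedGroup.of, mul_assoc]
theorem rot2_symm_zb2 : rot2.toMulEquiv.symm (zb 2) = (za 2)⁻¹ := by
  rw [rot2, ofGens_symm_of]; simp [rot2InvGen, PresentedGroup.of]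

theorem aut02_za0 : aut02.toMulEquiv (za 0) = za 0 := by
  rw [aut02, ofGens_of]; simp [aut02Gen, PresentedGroup.of]
theorem aut02_za1 : aut02.toMulEquiv (za 1) = za 1 := by
  rw [aut02, ofGens_of]; simp [aut02Gen, PresentedGroup.of]
theorem aut02_zb1 : aut02.toMulEquiv (zb 1) = zb 1 * za 1 := by
  rw [aut02, ofGens_of]; simp [aut02Gen, PresentedGroup.of]
theorem aut02_za2 : aut02.toMulEquiv (za 2) = (za 2)⁻¹ * (zb 2)⁻¹ := by
  rw [aut02, ofGens_of]; simp [aut02Gen, PresentedGroup.of]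
theorem aut02_zb2 : aut02.toMulEquiv (zb 2) = zb 2 * za 2 * (zb 2)⁻¹ := by
  rw [aut02, ofGens_of]; simp [aut02Gen, PresentedGroup.of, mul_assoc]
theorem aut02_symm_za0 : aut02.toMulEquiv.symm (za 0) = za 0 := by
  rw [aut02, ofGens_symm_of]; simp [aut02InvGen, PresentedGroup.of]
theorem aut02_symm_za1 : aut02.toMulEquiv.symm (za 1) = za 1 := by
  rw [aut02, ofGens_symm_of]; simp [aut02InvGen, PresentedGroup.of]
theorem aut02_symm_zb1 : aut02.toMulEquiv.symm (zb 1) = zb 1 * (za 1)⁻¹ := by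
  rw [aut02, ofGens_symm_of]; simp [aut02InvGen, PresentedGroup.of]
theorem aut02_symm_za2 : aut02.toMulEquiv.symm (za 2) = za 2 * zb 2 * (za 2)⁻¹ := by
  rw [aut02, ofGens_symm_of]; simp [aut02InvGen, PresentedGroup.of, mul_assoc]
theorem aut02_symm_zb2 : aut02.toMulEquiv.symm (zb 2) = (zb 2)⁻¹ * (za 2)⁻¹ := by
  rw [aut02, ofGens_symm_of]; simp [aut02InvGen, PresentedGroup.of]

theorem aut12_za0 : aut12.toMulEquiv (za 0) = za 0 := by
  rw [aut12, ofGens_of]; simp [aut12Gen, PresentedGroup.of]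
theorem aut12_za1 : aut12.toMulEquiv (za 1) = (zb 1)⁻¹ := by
  rw [aut12, ofGens_of]; simp [aut12Gen, PresentedGroup.of]
theorem aut12_zb1 : aut12.toMulEquiv (zb 1) = zb 1 * za 1 := by
  rw [aut12, ofGens_of]; simp [aut12Gen, PresentedGroup.of]
theorem aut12_za2 : aut12.toMulEquiv (za 2) = za 2 * zb 2 := by
  rw [aut12, ofGens_of]; simp [aut12Gen, PresentedGroup.of]
theorem aut12_zb2 : aut12.toMulEquiv (zb 2) = zb 2 := by
  rw [aut12, ofGens_of]; simp [aut12Gen, PresentedGroup.of]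
theorem aut12_symm_za0 : aut12.toMulEquiv.symm (za 0) = za 0 := by
  rw [aut12, ofGens_symm_of]; simp [aut12InvGen, PresentedGroup.of]
theorem aut12_symm_za1 : aut12.toMulEquiv.symm (za 1) = za 1 * zb 1 := by
  rw [aut12, ofGens_symm_of]; simp [aut12InvGen, PresentedGroup.of]
theorem aut12_symm_zb1 : aut12.toMulEquiv.symm (zb 1) = (za 1)⁻¹ := by
  rw [aut12, ofGens_symm_of]; simp [aut12InvGen, PresentedGroup.of]
theorem aut12_symm_za2 : aut12.toMulEquiv.symm (za 2) = za 2 * (zb 2)⁻¹ := by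
  rw [aut12, ofGens_symm_of]; simp [aut12InvGen, PresentedGroup.of]
theorem aut12_symm_zb2 : aut12.toMulEquiv.symm (zb 2) = zb 2 := by
  rw [aut12, ofGens_symm_of]; simp [aut12InvGen, PresentedGroup.of]

/-- `N₀ = ⟪a₀,a₁,b₂⟫` in `za/zb` letters. [folklore] -/
theorem s4Kernels_zero_z : s4Kernels 0 = normalClosure {za 0, za 1, zb 2} := rfl
/-- `N₁ = ⟪a₀,b₁,a₂⟫`. [folklore] -/
theorem s4Kernels_one_z : s4Kernels 1 = normalClosure {za 0, zb 1, za 2} := rfl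

/-! ### The three standard pairs carried onto the pairs of `zKernels` -/

/-- `ρ₂ N₀ = Z₀ = ⟪a₀,a₁,a₂⟫`. [folklore] -/
theorem map_rot2_zero : (s4Kernels 0).map rot2.toMulEquiv.toMonoidHom = zKernels 0 := by
  rw [s4Kernels_zero_z, zKernels_zero]
  refine map_normalClosure_eq_of _ _ _ ?_ ?_
  · intro x hx
    simp only [Set.mem_insert_iff, Set.mem_singleton_iff] at hx
    rcases hx with rfl | rfl | rfl
    · rw [rot2_za0]; exact subset_normalClosure (by simp)
    · rw [rot2_za1]; exact subset_normalClosure (by simp)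
    · rw [rot2_zb2]; exact conj_mem_nc _ _ (subset_normalClosure (by simp))
  · intro y hy
    simp only [Set.mem_insert_iff, Set.mem_singleton_iff] at hy
    rcases hy with rfl | rfl | rfl
    · rw [rot2_symm_za0]; exact subset_normalClosure (by simp)
    · rw [rot2_symm_za1]; exact subset_normalClosure (by simp)
    · rw [rot2_symm_za2]; exact conj_mem_nc _ _ (subset_normalClosure (by simp))

/-- `ρ₂ N₁ = Z₁ = ⟪a₀,b₁,b₂⟫`. [folklore] -/
theorem map_rot2_one : (s4Kernels 1).map rot2.toMulEquiv.toMonoidHom = zKernels 1 := by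
  rw [s4Kernels_one_z, zKernels_one]
  refine map_normalClosure_eq_of _ _ _ ?_ ?_
  · intro x hx
    simp only [Set.mem_insert_iff, Set.mem_singleton_iff] at hx
    rcases hx with rfl | rfl | rfl
    · rw [rot2_za0]; exact subset_normalClosure (by simp)
    · rw [rot2_zb1]; exact subset_normalClosure (by simp)
    · rw [rot2_za2]; exact inv_mem (subset_normalClosure (by simp))
  · intro y hy
    simp only [Set.mem_insert_iff, Set.mem_singleton_iff] at hy
    rcases hy with rfl | rfl | rfl
    · rw [rot2_symm_za0]; exact subset_normalClosure (by simp)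
    · rw [rot2_symm_zb1]; exact subset_normalClosure (by simp)
    · rw [rot2_symm_zb2]; exact inv_mem (subset_normalClosure (by simp))

/-- `θ N₀ = Z₀`. [folklore] -/
theorem map_aut02_zero : (s4Kernels 0).map aut02.toMulEquiv.toMonoidHom = zKernels 0 := by
  rw [s4Kernels_zero_z, zKernels_zero]
  refine map_normalClosure_eq_of _ _ _ ?_ ?_
  · intro x hx
    simp only [Set.mem_insert_iff, Set.mem_singleton_iff] at hx
    rcases hx with rfl | rfl | rfl
    · rw [aut02_za0]; exact subset_normalClosure (by simp)
    · rw [aut02_za1]; exact subset_normalClosure (by simp)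
    · rw [aut02_zb2]; exact conj_mem_nc _ _ (subset_normalClosure (by simp))
  · intro y hy
    simp only [Set.mem_insert_iff, Set.mem_singleton_iff] at hy
    rcases hy with rfl | rfl | rfl
    · rw [aut02_symm_za0]; exact subset_normalClosure (by simp)
    · rw [aut02_symm_za1]; exact subset_normalClosure (by simp)
    · rw [aut02_symm_za2]; exact conj_mem_nc _ _ (subset_normalClosure (by simp))

/-- `θ N₁ = Z₂ = ⟪a₀, a₁b₁, a₂b₂⟫`. [folklore] -/
theorem map_aut02_one : (s4Kernels 1).map aut02.toMulEquiv.toMonoidHom = zKernels 2 := by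
  rw [s4Kernels_one_z, zKernels_two]
  refine map_normalClosure_eq_of _ _ _ ?_ ?_
  · intro x hx
    simp only [Set.mem_insert_iff, Set.mem_singleton_iff] at hx
    rcases hx with rfl | rfl | rfl
    · rw [aut02_za0]; exact subset_normalClosure (by simp)
    · rw [aut02_zb1]
      -- b₁a₁ = a₁⁻¹ (a₁b₁) a₁
      have h := conj_mem_nc' (za 1) (za 1 * zb 1)
        (subset_normalClosure (s := ({za 0, za 1 * zb 1, za 2 * zb 2} : Set (SurfaceGroup 3))) (by simp))
      simpa [mul_assoc] using h
    · rw [aut02_za2]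
      -- a₂⁻¹b₂⁻¹ = (b₂a₂)⁻¹, b₂a₂ = a₂⁻¹ (a₂b₂) a₂
      have h := conj_mem_nc' (za 2) (za 2 * zb 2)
        (subset_normalClosure (s := ({za 0, za 1 * zb 1, za 2 * zb 2} : Set (SurfaceGroup 3))) (by simp))
      have h' := inv_mem h
      simpa [mul_assoc] using h'
  · intro y hy
    simp only [Set.mem_insert_iff, Set.mem_singleton_iff] at hy
    rcases hy with rfl | rfl | rfl
    · rw [aut02_symm_za0]; exact subset_normalClosure (by simp)
    · rw [map_mul, aut02_symm_za1, aut02_symm_zb1]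
      -- a₁ · b₁ a₁⁻¹
      have h := conj_mem_nc (za 1) (zb 1)
        (subset_normalClosure (s := ({za 0, zb 1, za 2} : Set (SurfaceGroup 3))) (by simp))
      simpa [mul_assoc] using h
    · rw [map_mul, aut02_symm_za2, aut02_symm_zb2]
      -- (a₂ b₂ a₂⁻¹)(b₂⁻¹ a₂⁻¹) = a₂ · (b₂ a₂⁻¹ b₂⁻¹) · a₂⁻¹
      have ha : za 2 ∈ normalClosure ({za 0, zb 1, za 2} : Set (SurfaceGroup 3)) :=
        subset_normalClosure (by simp)
      have h : za 2 * (zb 2 * (za 2)⁻¹ * (zb 2)⁻¹) * (za 2)⁻¹ ∈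
          normalClosure ({za 0, zb 1, za 2} : Set (SurfaceGroup 3)) :=
        mul_mem (mul_mem ha (conj_mem_nc _ _ (inv_mem ha))) (inv_mem ha)
      simpa [mul_assoc] using h

/-- `λ N₀ = Z₁`. [folklore] -/
theorem map_aut12_zero : (s4Kernels 0).map aut12.toMulEquiv.toMonoidHom = zKernels 1 := by
  rw [s4Kernels_zero_z, zKernels_one]
  refine map_normalClosure_eq_of _ _ _ ?_ ?_
  · intro x hx
    simp only [Set.mem_insert_iff, Set.mem_singleton_iff] at hx
    rcases hx with rfl | rfl | rfl
    · rw [aut12_za0]; exact subset_normalClosure (by simp)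
    · rw [aut12_za1]; exact inv_mem (subset_normalClosure (by simp))
    · rw [aut12_zb2]; exact subset_normalClosure (by simp)
  · intro y hy
    simp only [Set.mem_insert_iff, Set.mem_singleton_iff] at hy
    rcases hy with rfl | rfl | rfl
    · rw [aut12_symm_za0]; exact subset_normalClosure (by simp)
    · rw [aut12_symm_zb1]; exact inv_mem (subset_normalClosure (by simp))
    · rw [aut12_symm_zb2]; exact subset_normalClosure (by simp)

/-- `λ N₁ = Z₂`. [folklore] -/
theorem map_aut12_one : (s4Kernels 1).map aut12.toMulEquiv.toMonoidHom = zKernels 2 := by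
  rw [s4Kernels_one_z, zKernels_two]
  refine map_normalClosure_eq_of _ _ _ ?_ ?_
  · intro x hx
    simp only [Set.mem_insert_iff, Set.mem_singleton_iff] at hx
    rcases hx with rfl | rfl | rfl
    · rw [aut12_za0]; exact subset_normalClosure (by simp)
    · rw [aut12_zb1]
      have h := conj_mem_nc' (za 1) (za 1 * zb 1)
        (subset_normalClosure (s := ({za 0, za 1 * zb 1, za 2 * zb 2} : Set (SurfaceGroup 3))) (by simp))
      simpa [mul_assoc] using h
    · rw [aut12_za2]; exact subset_normalClosure (by simp)
  · intro y hy
    simp only [Set.mem_insert_iff, Set.mem_singleton_iff] at hy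
    rcases hy with rfl | rfl | rfl
    · rw [aut12_symm_za0]; exact subset_normalClosure (by simp)
    · rw [map_mul, aut12_symm_za1, aut12_symm_zb1]
      have h := conj_mem_nc (za 1) (zb 1)
        (subset_normalClosure (s := ({za 0, zb 1, za 2} : Set (SurfaceGroup 3))) (by simp))
      simpa [mul_assoc] using h
    · rw [map_mul, aut12_symm_za2, aut12_symm_zb2]
      have ha : za 2 ∈ normalClosure ({za 0, zb 1, za 2} : Set (SurfaceGroup 3)) :=
        subset_normalClosure (by simp)
      simpa using ha

/-- PAIR `(0,1)`: `ρ₂ (N₀, N₁) = (Z₀, Z₁)`. [folklore] -/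
theorem pair01_zKernels : ∃ α : SurfaceGroup 3 ≃* SurfaceGroup 3,
    (s4Kernels 0).map α.toMonoidHom = zKernels 0 ∧ (s4Kernels 1).map α.toMonoidHom = zKernels 1 :=
  ⟨rot2.toMulEquiv, map_rot2_zero, map_rot2_one⟩

/-- PAIR `(0,2)`: `θ ∘ (cyc ∘ swp)` carries `(N₀, N₂)` to `(Z₀, Z₂)` (the slot symmetry
`swp.trans cyc` realises the transposition `N₁ ↔ N₂` fixing `N₀`). [folklore] -/
theorem pair02_zKernels : ∃ α : SurfaceGroup 3 ≃* SurfaceGroup 3,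
    (s4Kernels 0).map α.toMonoidHom = zKernels 0 ∧ (s4Kernels 2).map α.toMonoidHom = zKernels 2 := by
  refine ⟨((swp.trans cyc).trans aut02).toMulEquiv, ?_, ?_⟩
  · rw [map_toMulEquiv_trans, map_toMulEquiv_trans, map_swp_zero, map_cyc_one, map_aut02_zero]
  · rw [map_toMulEquiv_trans, map_toMulEquiv_trans, map_swp_two, map_cyc_two, map_aut02_one]

/-- PAIR `(1,2)`: `λ ∘ cyc` carries `(N₁, N₂)` to `(Z₁, Z₂)` (`cyc : N₁ ↦ N₀, N₂ ↦ N₁`).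
[folklore] -/
theorem pair12_zKernels : ∃ α : SurfaceGroup 3 ≃* SurfaceGroup 3,
    (s4Kernels 1).map α.toMonoidHom = zKernels 1 ∧ (s4Kernels 2).map α.toMonoidHom = zKernels 2 := by
  refine ⟨(cyc.trans aut12).toMulEquiv, ?_, ?_⟩
  · rw [map_toMulEquiv_trans, map_cyc_one, map_aut12_zero]
  · rw [map_toMulEquiv_trans, map_cyc_two, map_aut12_one]

/-- **The `(3,1)` trisection `zKernels` of `S¹×S³ # ℂP² # ℂP²` is in WALDHAUSEN NORMAL FORM**:
each of its three ordered Heegaard pairs is the image of the corresponding standard pair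
`(N_i, N_j)` of the genus-3 trisection of `S⁴` under ONE automorphism of `S_3`. [folklore] -/
theorem pairs_zKernels (i j : Fin 3) (hij : i ≠ j) :
    ∃ α : SurfaceGroup 3 ≃* SurfaceGroup 3,
      (s4Kernels i).map α.toMonoidHom = zKernels i ∧ (s4Kernels j).map α.toMonoidHom = zKernels j := by
  have key : ∀ i j : Fin 3, i < j → ∃ α : SurfaceGroup 3 ≃* SurfaceGroup 3,
      (s4Kernels i).map α.toMonoidHom = zKernels i ∧ (s4Kernels j).map α.toMonoidHom = zKernels j := by
    intro i j h
    fin_cases i <;> fin_cases j <;>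
      first
      | exact absurd h (by decide)
      | exact pair01_zKernels
      | exact pair02_zKernels
      | exact pair12_zKernels
  rcases lt_or_gt_of_ne hij with h | h
  · exact key i j h
  · obtain ⟨α, h1, h2⟩ := key j i h
    exact ⟨α, h2, h1⟩


/-- `PairsStandard 0 zKernels` (`N = s4Kernels.stabilizeIter 0 = s4Kernels` definitionally).
[folklore] -/
theorem pairsStandard_zKernels : PairsStandard 0 zKernels := fun i j hij => pairs_zKernels i j hij

/-- The triple quotient of `zKernels` is non-trivial (`π₁ = ℤ`, detected in `ℤ/2`). [folklore] -/
theorem nontrivial_tripleQuotient_zKernels : Nontrivial zKernels.tripleQuotient :=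
  not_subsingleton_iff_nontrivial.1 not_subsingleton_tripleQuotient_zKernels

/-- The crux with `PUnit` replaced by an arbitrary group (equivalently, by §2: with `triple`
dropped). [folklore] -/
def NormalFormStablyTrivialAnyGroup : Prop :=
  ∀ (m : ℕ) (K : TrisectionKernels (3 + 3 * m)) (G : Type) [Group G],
    IsGroupTrisection (3 + 3 * m) (m + 1) G K → PairsStandard m K → K.IsStablyTrivial

/-- The crux with the whole `IsGroupTrisection` hypothesis dropped (by §2 only `triple` is lost).
[folklore] -/
def NormalFormStablyTrivialWithoutHyp : Prop :=
  ∀ (m : ℕ) (K : TrisectionKernels (3 + 3 * m)), PairsStandard m K → K.IsStablyTrivial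

/-- **LOAD-BEARING `triple` (`π₁ = 1`).**  The any-group version of the crux is FALSE: the
`(3;1,1,1)` trisection `zKernels` of `S¹×S³ # ℂP² # ℂP²` is a group trisection of `ℤ` in Waldhausen
normal form (`pairs_zKernels`) which is not stably trivial.  Any proof of the crux must use the
triviality of the triple quotient. [folklore] -/
theorem normalFormStablyTrivial_false_without_triple : ¬ NormalFormStablyTrivialAnyGroup :=
  fun h => not_isStablyTrivial_zKernels
    (h 0 zKernels zKernels.tripleQuotient zKernels_isGroupTrisection pairsStandard_zKernels)

/-- Same witness: dropping the whole `IsGroupTrisection` hypothesis is fatal. [folklore] -/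
theorem normalFormStablyTrivial_false_without_hyp : ¬ NormalFormStablyTrivialWithoutHyp :=
  fun h => not_isStablyTrivial_zKernels (h 0 zKernels pairsStandard_zKernels)

/-- The triple form with `Subsingleton` weakened to nothing is the statement just refuted; recorded
as the contrapositive usable by provers: a normal form that is NOT stably trivial has `π₁ ≠ 1`
**or** is a counterexample to the crux. [folklore] -/
theorem nontrivial_or_counterexample (h : NormalFormStablyTrivial) {m : ℕ}
    {K : TrisectionKernels (3 + 3 * m)} (hP : PairsStandard m K) (hK : ¬ K.IsStablyTrivial) :
    Nontrivial K.tripleQuotient := by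
  rw [normalFormStablyTrivial_iff_tripleForm] at h
  by_contra hnt
  rw [not_nontrivial_iff_subsingleton] at hnt
  exact hK (h m K hnt hP)

/-! ## §4 The gate form (`(0,1)`-normalised triples) and the Nielsen gap -/

/-- GATE FORM of the crux: triples whose first two kernels ARE the standard pair `(N₀, N₁)`, with
`π₁ = 1` and `K₂` in the gate `Stab(N₀)·N₂ ∩ Stab(N₁)·N₂`, are stably trivial. [folklore] -/
def GateForm : Prop :=
  ∀ (m : ℕ) (K : TrisectionKernels (3 + 3 * m)),
    K 0 = s4Kernels.stabilizeIter m 0 → K 1 = s4Kernels.stabilizeIter m 1 →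
    Subsingleton K.tripleQuotient →
    (∃ β : SurfaceGroup (3 + 3 * m) ≃* SurfaceGroup (3 + 3 * m),
      (s4Kernels.stabilizeIter m 0).map β.toMonoidHom = s4Kernels.stabilizeIter m 0 ∧
      (s4Kernels.stabilizeIter m 2).map β.toMonoidHom = K 2) →
    (∃ γ : SurfaceGroup (3 + 3 * m) ≃* SurfaceGroup (3 + 3 * m),
      (s4Kernels.stabilizeIter m 1).map γ.toMonoidHom = s4Kernels.stabilizeIter m 1 ∧
      (s4Kernels.stabilizeIter m 2).map γ.toMonoidHom = K 2) →
    K.IsStablyTrivial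

/-- `IsStablyTrivial` is invariant under isomorphism of kernel triples (re-marking by any
automorphism of `S_g`).  TRUE on paper (Nielsen 1927 + `iso_stabilize_map_of_lift`); in tree only
for liftable automorphisms.  Stated here as a hypothesis, never asserted. [cite: Nielsen1927] -/
def IsoInvariant : Prop :=
  ∀ (g : ℕ) (K K' : TrisectionKernels g), K.Iso K' → K.IsStablyTrivial → K'.IsStablyTrivial

/-- A `(0,1)`-normalised triple with gate data is in normal form. [folklore] -/
theorem pairsStandard_of_gate {K : TrisectionKernels (3 + 3 * m)}
    (h0 : K 0 = s4Kernels.stabilizeIter m 0) (h1 : K 1 = s4Kernels.stabilizeIter m 1)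
    (hβ : ∃ β : SurfaceGroup (3 + 3 * m) ≃* SurfaceGroup (3 + 3 * m),
      (s4Kernels.stabilizeIter m 0).map β.toMonoidHom = s4Kernels.stabilizeIter m 0 ∧
      (s4Kernels.stabilizeIter m 2).map β.toMonoidHom = K 2)
    (hγ : ∃ γ : SurfaceGroup (3 + 3 * m) ≃* SurfaceGroup (3 + 3 * m),
      (s4Kernels.stabilizeIter m 1).map γ.toMonoidHom = s4Kernels.stabilizeIter m 1 ∧
      (s4Kernels.stabilizeIter m 2).map γ.toMonoidHom = K 2) :
    PairsStandard m K := by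
  obtain ⟨β, hb0, hb2⟩ := hβ
  obtain ⟨γ, hc1, hc2⟩ := hγ
  have p01 : ∃ α : SurfaceGroup (3 + 3 * m) ≃* SurfaceGroup (3 + 3 * m),
      (s4Kernels.stabilizeIter m 0).map α.toMonoidHom = K 0 ∧
      (s4Kernels.stabilizeIter m 1).map α.toMonoidHom = K 1 :=
    ⟨MulEquiv.refl _, by simpa using h0.symm, by simpa using h1.symm⟩
  have p02 : ∃ α : SurfaceGroup (3 + 3 * m) ≃* SurfaceGroup (3 + 3 * m),
      (s4Kernels.stabilizeIter m 0).map α.toMonoidHom = K 0 ∧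
      (s4Kernels.stabilizeIter m 2).map α.toMonoidHom = K 2 := ⟨β, hb0.trans h0.symm, hb2⟩
  have p12 : ∃ α : SurfaceGroup (3 + 3 * m) ≃* SurfaceGroup (3 + 3 * m),
      (s4Kernels.stabilizeIter m 1).map α.toMonoidHom = K 1 ∧
      (s4Kernels.stabilizeIter m 2).map α.toMonoidHom = K 2 := ⟨γ, hc1.trans h1.symm, hc2⟩
  intro i j hij
  fin_cases i <;> fin_cases j <;>
    first
    | exact absurd rfl hij
    | exact p01
    | exact p02
    | exact p12
    | (obtain ⟨α, ha, hb⟩ := p01; exact ⟨α, hb, ha⟩)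
    | (obtain ⟨α, ha, hb⟩ := p02; exact ⟨α, hb, ha⟩)
    | (obtain ⟨α, ha, hb⟩ := p12; exact ⟨α, hb, ha⟩)

/-- **crux ⇒ gate form** (unconditional). [folklore] -/
theorem gateForm_of_normalFormStablyTrivial (h : NormalFormStablyTrivial) : GateForm := by
  rw [normalFormStablyTrivial_iff_tripleForm] at h
  intro m K h0 h1 hs hβ hγ
  exact h m K hs (pairsStandard_of_gate h0 h1 hβ hγ)

/-- **gate form + `Iso`-invariance of stable triviality ⇒ crux.**  Pull `K` back along the
automorphism `α₀₁` standardising the pair `(K₀, K₁)`; the pulled-back triple is `(0,1)`-normalised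
with gate data, hence stably trivial by `GateForm`; push forward with `IsoInvariant`.  This is
where "WLOG `(K₀,K₁) = (N₀,N₁)`" costs Nielsen. [folklore] -/
theorem normalFormStablyTrivial_of_gateForm (hI : IsoInvariant) (hG : GateForm) :
    NormalFormStablyTrivial := by
  rw [normalFormStablyTrivial_iff_tripleForm]
  intro m K hs hP
  obtain ⟨α, h0, h1⟩ := hP 0 1 (by decide)
  -- the pulled-back triple
  let K' : TrisectionKernels (3 + 3 * m) := fun i => (K i).map α.symm.toMonoidHom
  have hcomp : α.toMonoidHom.comp α.symm.toMonoidHom = MonoidHom.id _ :=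
    MonoidHom.ext fun x => α.apply_symm_apply x
  have hcomp' : α.symm.toMonoidHom.comp α.toMonoidHom = MonoidHom.id _ :=
    MonoidHom.ext fun x => α.symm_apply_apply x
  have hback : ∀ i, (K' i).map α.toMonoidHom = K i := fun i => by
    show ((K i).map α.symm.toMonoidHom).map α.toMonoidHom = K i
    rw [Subgroup.map_map, hcomp, Subgroup.map_id]
  have hK'0 : K' 0 = s4Kernels.stabilizeIter m 0 := by
    show (K 0).map α.symm.toMonoidHom = _
    rw [← h0, Subgroup.map_map, hcomp', Subgroup.map_id]
  have hK'1 : K' 1 = s4Kernels.stabilizeIter m 1 := by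
    show (K 1).map α.symm.toMonoidHom = _
    rw [← h1, Subgroup.map_map, hcomp', Subgroup.map_id]
  have hP' : PairsStandard m K' := by
    intro i j hij
    obtain ⟨δ, hi, hj⟩ := hP i j hij
    have ht : (δ.trans α.symm).toMonoidHom = α.symm.toMonoidHom.comp δ.toMonoidHom :=
      MonoidHom.ext fun _ => rfl
    refine ⟨δ.trans α.symm, ?_, ?_⟩
    · rw [ht, ← Subgroup.map_map, hi]
    · rw [ht, ← Subgroup.map_map, hj]
  have hIso : TrisectionKernels.Iso K' K := ⟨α, hback⟩
  obtain ⟨e⟩ := Iso.nonempty_tripleQuotient_equiv hIso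
  have hs' : Subsingleton K'.tripleQuotient := e.toEquiv.subsingleton
  obtain ⟨β, hb0, hb2⟩ := hP' 0 2 (by decide)
  obtain ⟨γ, hc1, hc2⟩ := hP' 1 2 (by decide)
  have hst' : K'.IsStablyTrivial :=
    hG m K' hK'0 hK'1 hs' ⟨β, hb0.trans hK'0, hb2⟩ ⟨γ, hc1.trans hK'1, hc2⟩
  exact hI _ K' K hIso hst'


/-- **Nielsen ⇒ `Iso`-invariance of stable triviality.**  Granted the tree's Nielsen hypothesis
`hN` (every automorphism of every `S_G` lifts to the free group sending the relator to a conjugate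
of `r^{±1}`; the hypothesis of `TrisectionKernels.Iso.stabilizeIter_of_liftable`,
TrisectionFunctorSPC4Proofs.lean — Nielsen 1927 + Magnus, true on paper, not proved in tree),
isomorphic kernel triples are stably trivial together. [cite: Nielsen1927] -/
theorem isoInvariant_of_nielsen
    (hN : ∀ (G : ℕ) (α : SurfaceGroup G ≃* SurfaceGroup G),
      ∃ (φ : FreeGroup (surfaceGen G) ≃* FreeGroup (surfaceGen G)) (c : FreeGroup (surfaceGen G))
        (ε : ℤ), (ε = 1 ∨ ε = -1) ∧ φ (surfaceRelator G) = c * surfaceRelator G ^ ε * c⁻¹ ∧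
        ∀ x, PresentedGroup.mk _ (φ x) = α (PresentedGroup.mk _ x))
    (g : ℕ) (K K' : TrisectionKernels g) (h : K.Iso K') (hK : K.IsStablyTrivial) :
    K'.IsStablyTrivial := by
  obtain ⟨n, m, e, hiso⟩ := hK
  exact ⟨n, m, e, (TrisectionKernels.Iso.stabilizeIter_of_liftable hN h n).symm.trans hiso⟩

/-- **Modulo Nielsen (the tree's registered gap `hN`) the crux IS its gate form.** [cite: Nielsen1927] -/
theorem normalFormStablyTrivial_iff_gate_of_nielsen
    (hN : ∀ (G : ℕ) (α : SurfaceGroup G ≃* SurfaceGroup G),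
      ∃ (φ : FreeGroup (surfaceGen G) ≃* FreeGroup (surfaceGen G)) (c : FreeGroup (surfaceGen G))
        (ε : ℤ), (ε = 1 ∨ ε = -1) ∧ φ (surfaceRelator G) = c * surfaceRelator G ^ ε * c⁻¹ ∧
        ∀ x, PresentedGroup.mk _ (φ x) = α (PresentedGroup.mk _ x)) :
    NormalFormStablyTrivial ↔ GateForm :=
  ⟨gateForm_of_normalFormStablyTrivial, normalFormStablyTrivial_of_gateForm (isoInvariant_of_nielsen hN)⟩

/-! ## §5 Refuted strengthening (pointer, sibling theorem re-exported at this crux) -/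

/-- "An automorphism standardising the PAIR `(K₀,K₁)` also standardises `K₂`" is FALSE already for
`S⁴` (`m = 0`, `K = N`, `α = T₀` the Dehn twist about the shared curve `a₁`; sibling crux
`WaldhausenPairs`, `StandardPairSymmetries.lean`).  The three `α_{ij}` of a normal form differ by
Heegaard-group elements that move the third kernel: the crux is exactly the passage from three
pairwise to one simultaneous automorphism, stably. [folklore] -/
theorem not_pairsDetermineThird' :
    ¬ ∀ (m : ℕ) (K : TrisectionKernels (3 + 3 * m)),
      IsGroupTrisection (3 + 3 * m) (m + 1) (PUnit : Type) K →
      ∀ α : SurfaceGroup (3 + 3 * m) ≃* SurfaceGroup (3 + 3 * m),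
        (s4Kernels.stabilizeIter m 0).map α.toMonoidHom = K 0 →
        (s4Kernels.stabilizeIter m 1).map α.toMonoidHom = K 1 →
        (s4Kernels.stabilizeIter m 2).map α.toMonoidHom = K 2 :=
  not_pairsDetermineThird

-- Targets: none yet (no line picked; payload `stuck_stubs = []`).

/-! ## §6 The gate needs BOTH sides: pair ranks obstruct; the unbalanced trisections of `ℂP²`

### §6.1 Pair ranks are stable invariants -/

/-- The `(i,j)` pair quotient of a stabilisation is the free product of the old one with `F_1`:
rank goes up by one (the pair clause of `stabilize_isGroupTrisection_holds`, for an arbitrary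
triple). [cite: AbramsGayKirby2018, Def. 2–3] -/
theorem isFreeOfRank_pairQuotient_stabilize {g : ℕ} (K : TrisectionKernels g) {i j : Fin 3}
    (hij : i ≠ j) {r : ℕ} (h : IsFreeOfRank (K.pairQuotient i j) r) :
    IsFreeOfRank (K.stabilize.pairQuotient i j) (r + 1) := by
  have e := stabQuotientEquivCoprod ((K i : Set (SurfaceGroup g)) ∪ K j)
    ((s4Kernels i : Set (SurfaceGroup 3)) ∪ s4Kernels j) (Or.inl (one_mem _)) (Or.inl (one_mem _))
  have h2 := h.coprod (s4Kernels_isGroupTrisection_holds.free_pairQuotient i j hij)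
  refine (h2.of_mulEquiv e.symm).of_mulEquiv (QuotientGroup.quotientMulEquivOfEq ?_)
  rw [TrisectionKernels.stabilize_apply, TrisectionKernels.stabilize_apply,
    normalClosure_union_normalClosure, stabSet_union]

/-- Iterated: the `(i,j)` pair quotient of `K.stabilizeIter n` is free of rank `r + n`. [folklore] -/
theorem isFreeOfRank_pairQuotient_stabilizeIter {g : ℕ} (K : TrisectionKernels g) {i j : Fin 3}
    (hij : i ≠ j) {r : ℕ} (h : IsFreeOfRank (K.pairQuotient i j) r) :
    ∀ n : ℕ, IsFreeOfRank ((K.stabilizeIter n).pairQuotient i j) (r + n)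
  | 0 => h
  | n + 1 => isFreeOfRank_pairQuotient_stabilize _ hij (isFreeOfRank_pairQuotient_stabilizeIter K hij h n)

/-- **PAIR RANKS OBSTRUCT STABLE TRIVIALITY.**  A genus-`3+3m` triple with an `(i,j)` pair
quotient free of rank `r ≠ m + 1` is not stably trivial (the standard triple of genus `3+3m'`
has all pair ranks `m'+1`, ranks add under stabilisation, and the genus bookkeeping forces
`m' = m + n`). [folklore] -/
theorem not_isStablyTrivial_of_pairRank {m : ℕ} {K : TrisectionKernels (3 + 3 * m)} {i j : Fin 3}
    (hij : i ≠ j) {r : ℕ} (h : IsFreeOfRank (K.pairQuotient i j) r) (hr : r ≠ m + 1) :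
    ¬ K.IsStablyTrivial := by
  rintro ⟨n, m', hg, hiso⟩
  have h1 := isFreeOfRank_pairQuotient_stabilizeIter K hij h n
  have h2 := (isGroupTrisection_cast (stabilizeIter_isGroupTrisection m') hg).free_pairQuotient i j hij
  obtain ⟨e⟩ := Iso.nonempty_pairQuotient_equiv hiso i j
  have h3 := IsFreeOfRank.rank_eq (h1.of_mulEquiv e) h2
  omega

/-! ### §6.2 The Dehn twists `T_{b_h} : a_h ↦ a_h b_h` -/

/-- Generator images of `T_{b_h}`: `a_h ↦ a_h b_h`, everything else fixed. [folklore] -/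
def twBGen (h : Fin 3) (x : surfaceGen 3) : FreeGroup (surfaceGen 3) :=
  if x = (h, false) then FreeGroup.of (h, false) * FreeGroup.of (h, true) else FreeGroup.of x

/-- Generator images of `T_{b_h}⁻¹`: `a_h ↦ a_h b_h⁻¹`. [folklore] -/
def twBInvGen (h : Fin 3) (x : surfaceGen 3) : FreeGroup (surfaceGen 3) :=
  if x = (h, false) then FreeGroup.of (h, false) * (FreeGroup.of (h, true))⁻¹ else FreeGroup.of x

/-- `T_{b_h}` as a relator-fixing automorphism of `S_3` (`[a b, b] = [a, b]` letter for letter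
after free reduction; identities by `decide`). [folklore] -/
def twB (h : Fin 3) : RelatorAut 3 :=
  ofGens (twBGen h) (twBInvGen h) (by fin_cases h <;> decide) (by fin_cases h <;> decide)
    (by fin_cases h <;> decide) (by fin_cases h <;> decide)

/-- `T_{b_h}` fixes every generator other than `a_h`. [folklore] -/
theorem twB_of {h : Fin 3} {x : surfaceGen 3} (hx : x ≠ (h, false)) :
    (twB h).toMulEquiv (PresentedGroup.of x) = PresentedGroup.of x := by
  rw [twB, ofGens_of]; simp [twBGen, hx, PresentedGroup.of]

/-- `T_{b_h} a_h = a_h b_h`. [folklore] -/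
theorem twB_a (h : Fin 3) : (twB h).toMulEquiv (za h) = za h * zb h := by
  rw [twB, ofGens_of]; simp [twBGen, PresentedGroup.of]

/-- `T_{b_h}⁻¹` fixes every generator other than `a_h`. [folklore] -/
theorem twB_symm_of {h : Fin 3} {x : surfaceGen 3} (hx : x ≠ (h, false)) :
    (twB h).toMulEquiv.symm (PresentedGroup.of x) = PresentedGroup.of x := by
  rw [twB, ofGens_symm_of]; simp [twBInvGen, hx, PresentedGroup.of]

/-- `T_{b_h}⁻¹ a_h = a_h b_h⁻¹`. [folklore] -/
theorem twB_symm_a (h : Fin 3) : (twB h).toMulEquiv.symm (za h) = za h * (zb h)⁻¹ := by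
  rw [twB, ofGens_symm_of]; simp [twBInvGen, PresentedGroup.of]

/-- A twist that fixes each listed generator fixes their normal closure. [folklore] -/
theorem map_twB_normalClosure_of_forall {h : Fin 3} (s : Set (surfaceGen 3))
    (hs : ∀ x ∈ s, x ≠ (h, false)) :
    (normalClosure (PresentedGroup.of '' s)).map (twB h).toMulEquiv.toMonoidHom =
      normalClosure (PresentedGroup.of '' s) := by
  refine map_normalClosure_eq_of _ _ _ ?_ ?_
  · rintro _ ⟨x, hx, rfl⟩
    rw [twB_of (hs x hx)]; exact subset_normalClosure ⟨x, hx, rfl⟩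
  · rintro _ ⟨x, hx, rfl⟩
    rw [twB_symm_of (hs x hx)]; exact subset_normalClosure ⟨x, hx, rfl⟩

/-- `T_{b₂} ∈ Stab N₀` (`N₀ = ⟪a₀,a₁,b₂⟫`: `b₂` bounds in `H₀`). [folklore] -/
theorem map_twB2_s4Kernels_zero : (s4Kernels 0).map (twB 2).toMulEquiv.toMonoidHom = s4Kernels 0 := by
  rw [s4Kernels_eq]
  exact map_twB_normalClosure_of_forall _ (by decide)

/-- `T_{b₁} ∈ Stab N₁` (`N₁ = ⟪a₀,b₁,a₂⟫`). [folklore] -/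
theorem map_twB1_s4Kernels_one : (s4Kernels 1).map (twB 1).toMulEquiv.toMonoidHom = s4Kernels 1 := by
  rw [s4Kernels_eq]
  exact map_twB_normalClosure_of_forall _ (by decide)

/-- `T_{b₀} ∈ Stab N₂` (`N₂ = ⟪b₀,a₁,a₂⟫`). [folklore] -/
theorem map_twB0_s4Kernels_two : (s4Kernels 2).map (twB 0).toMulEquiv.toMonoidHom = s4Kernels 2 := by
  rw [s4Kernels_eq]
  exact map_twB_normalClosure_of_forall _ (by decide)

/-- `N₂ = ⟪b₀,a₁,a₂⟫` in `za/zb` letters. [folklore] -/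
theorem s4Kernels_two_z : s4Kernels 2 = normalClosure {zb 0, za 1, za 2} := rfl

/-- `T_{b₂} N₂ = ⟪b₀, a₁, a₂b₂⟫`. [folklore] -/
theorem map_twB2_s4Kernels_two :
    (s4Kernels 2).map (twB 2).toMulEquiv.toMonoidHom = normalClosure {zb 0, za 1, za 2 * zb 2} := by
  rw [s4Kernels_two_z]
  refine map_normalClosure_eq_of _ _ _ ?_ ?_
  · intro x hx
    simp only [Set.mem_insert_iff, Set.mem_singleton_iff] at hx
    rcases hx with rfl | rfl | rfl
    · rw [show zb 0 = PresentedGroup.of ((0 : Fin 3), true) from rfl, twB_of (by decide)]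
      exact subset_normalClosure (by simp)
    · rw [show za 1 = PresentedGroup.of ((1 : Fin 3), false) from rfl, twB_of (by decide)]
      exact subset_normalClosure (by simp)
    · rw [twB_a]; exact subset_normalClosure (by simp)
  · intro y hy
    simp only [Set.mem_insert_iff, Set.mem_singleton_iff] at hy
    rcases hy with rfl | rfl | rfl
    · rw [show zb 0 = PresentedGroup.of ((0 : Fin 3), true) from rfl, twB_symm_of (by decide)]
      exact subset_normalClosure (by simp)
    · rw [show za 1 = PresentedGroup.of ((1 : Fin 3), false) from rfl, twB_symm_of (by decide)]
      exact subset_normalClosure (by simp)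
    · rw [map_mul, twB_symm_a, show zb 2 = PresentedGroup.of ((2 : Fin 3), true) from rfl,
        twB_symm_of (by decide)]
      have : za 2 * (PresentedGroup.of ((2 : Fin 3), true))⁻¹ * PresentedGroup.of ((2 : Fin 3), true) = za 2 := by
        simp
      rw [this]; exact subset_normalClosure (by simp)

/-- `T_{b₁} N₂ = ⟪b₀, a₁b₁, a₂⟫`. [folklore] -/
theorem map_twB1_s4Kernels_two :
    (s4Kernels 2).map (twB 1).toMulEquiv.toMonoidHom = normalClosure {zb 0, za 1 * zb 1, za 2} := by
  rw [s4Kernels_two_z]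
  refine map_normalClosure_eq_of _ _ _ ?_ ?_
  · intro x hx
    simp only [Set.mem_insert_iff, Set.mem_singleton_iff] at hx
    rcases hx with rfl | rfl | rfl
    · rw [show zb 0 = PresentedGroup.of ((0 : Fin 3), true) from rfl, twB_of (by decide)]
      exact subset_normalClosure (by simp)
    · rw [twB_a]; exact subset_normalClosure (by simp)
    · rw [show za 2 = PresentedGroup.of ((2 : Fin 3), false) from rfl, twB_of (by decide)]
      exact subset_normalClosure (by simp)
  · intro y hy
    simp only [Set.mem_insert_iff, Set.mem_singleton_iff] at hy
    rcases hy with rfl | rfl | rfl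
    · rw [show zb 0 = PresentedGroup.of ((0 : Fin 3), true) from rfl, twB_symm_of (by decide)]
      exact subset_normalClosure (by simp)
    · rw [map_mul, twB_symm_a, show zb 1 = PresentedGroup.of ((1 : Fin 3), true) from rfl,
        twB_symm_of (by decide)]
      have : za 1 * (PresentedGroup.of ((1 : Fin 3), true))⁻¹ * PresentedGroup.of ((1 : Fin 3), true) = za 1 := by
        simp
      rw [this]; exact subset_normalClosure (by simp)
    · rw [show za 2 = PresentedGroup.of ((2 : Fin 3), false) from rfl, twB_symm_of (by decide)]
      exact subset_normalClosure (by simp)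

/-- `N₁ = ⟪a₀,b₁,a₂⟫` in `za/zb` letters. [folklore] -/
theorem s4Kernels_one_z' : s4Kernels 1 = normalClosure {za 0, zb 1, za 2} := rfl

/-- `T_{b₀} N₁ = ⟪a₀b₀, b₁, a₂⟫`. [folklore] -/
theorem map_twB0_s4Kernels_one :
    (s4Kernels 1).map (twB 0).toMulEquiv.toMonoidHom = normalClosure {za 0 * zb 0, zb 1, za 2} := by
  rw [s4Kernels_one_z']
  refine map_normalClosure_eq_of _ _ _ ?_ ?_
  · intro x hx
    simp only [Set.mem_insert_iff, Set.mem_singleton_iff] at hx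
    rcases hx with rfl | rfl | rfl
    · rw [twB_a]; exact subset_normalClosure (by simp)
    · rw [show zb 1 = PresentedGroup.of ((1 : Fin 3), true) from rfl, twB_of (by decide)]
      exact subset_normalClosure (by simp)
    · rw [show za 2 = PresentedGroup.of ((2 : Fin 3), false) from rfl, twB_of (by decide)]
      exact subset_normalClosure (by simp)
  · intro y hy
    simp only [Set.mem_insert_iff, Set.mem_singleton_iff] at hy
    rcases hy with rfl | rfl | rfl
    · rw [map_mul, twB_symm_a, show zb 0 = PresentedGroup.of ((0 : Fin 3), true) from rfl,
        twB_symm_of (by decide)]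
      have : za 0 * (PresentedGroup.of ((0 : Fin 3), true))⁻¹ * PresentedGroup.of ((0 : Fin 3), true) = za 0 := by
        simp
      rw [this]; exact subset_normalClosure (by simp)
    · rw [show zb 1 = PresentedGroup.of ((1 : Fin 3), true) from rfl, twB_symm_of (by decide)]
      exact subset_normalClosure (by simp)
    · rw [show za 2 = PresentedGroup.of ((2 : Fin 3), false) from rfl, twB_symm_of (by decide)]
      exact subset_normalClosure (by simp)

/-! ### §6.3 Three unbalanced trisections of `ℂP²` and their pair ranks -/

/-- `(N₀, N₁, T_{b₂}N₂)`: the `(3;1,1,0)` trisection of `ℂP²` (`ℂP²` summand on handle 2).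
(Defined by `Function.update`, not `![…]`: unification of two `![…]` literals is pathological.)
[folklore] -/
def cpA : TrisectionKernels 3 :=
  Function.update s4Kernels 2 (normalClosure {zb 0, za 1, za 2 * zb 2})
/-- `(N₀, N₁, T_{b₁}N₂)`: the `(3;1,0,1)` trisection of `ℂP²` (`ℂP²` summand on handle 1).
[folklore] -/
def cpB : TrisectionKernels 3 :=
  Function.update s4Kernels 2 (normalClosure {zb 0, za 1 * zb 1, za 2})
/-- `(N₀, T_{b₀}N₁, N₂)`: the `(3;0,1,1)` trisection of `ℂP²` (`ℂP²` summand on handle 0).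
[folklore] -/
def cpC : TrisectionKernels 3 :=
  Function.update s4Kernels 1 (normalClosure {za 0 * zb 0, zb 1, za 2})

/-- slot `0` of `cpA`. [folklore] -/
theorem cpA_zero : cpA 0 = s4Kernels 0 := Function.update_of_ne (by decide) _ _
/-- slot `1` of `cpA`. [folklore] -/
theorem cpA_one : cpA 1 = s4Kernels 1 := Function.update_of_ne (by decide) _ _
/-- slot `2` of `cpA`. [folklore] -/
theorem cpA_two : cpA 2 = normalClosure {zb 0, za 1, za 2 * zb 2} := Function.update_self _ _ _
/-- slot `0` of `cpB`. [folklore] -/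
theorem cpB_zero : cpB 0 = s4Kernels 0 := Function.update_of_ne (by decide) _ _
/-- slot `1` of `cpB`. [folklore] -/
theorem cpB_one : cpB 1 = s4Kernels 1 := Function.update_of_ne (by decide) _ _
/-- slot `2` of `cpB`. [folklore] -/
theorem cpB_two : cpB 2 = normalClosure {zb 0, za 1 * zb 1, za 2} := Function.update_self _ _ _
/-- slot `0` of `cpC`. [folklore] -/
theorem cpC_zero : cpC 0 = s4Kernels 0 := Function.update_of_ne (by decide) _ _
/-- slot `1` of `cpC`. [folklore] -/
theorem cpC_one : cpC 1 = normalClosure {za 0 * zb 0, zb 1, za 2} := Function.update_self _ _ _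
/-- slot `2` of `cpC`. [folklore] -/
theorem cpC_two : cpC 2 = s4Kernels 2 := Function.update_of_ne (by decide) _ _

/-- `s4Kernels.stabilizeIter 0 = s4Kernels`. [folklore] -/
theorem s4Kernels_stabilizeIter_zero : s4Kernels.stabilizeIter 0 = s4Kernels := rfl

section ranks

/-- If `x ∈ H` and `x * y ∈ H` then `y ∈ H`. [folklore] -/
theorem mem_of_mul_mem_left {G : Type*} [Group G] {H : Subgroup G} {x y : G} (hx : x ∈ H)
    (hxy : x * y ∈ H) : y ∈ H := by
  simpa using H.mul_mem (H.inv_mem hx) hxy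

variable (K : TrisectionKernels 3)

/-- Generators of a standard slot die in the triple quotient. [folklore] -/
theorem of_mem_nc_iUnion_of_eq {l : Fin 3} (hl : K l = s4Kernels l) {y : surfaceGen 3}
    (hy : y ∈ s4Gens l) :
    (PresentedGroup.of y : SurfaceGroup 3) ∈ normalClosure (⋃ i, (K i : Set (SurfaceGroup 3))) := by
  refine subset_normalClosure (Set.mem_iUnion.2 ⟨l, ?_⟩)
  rw [hl]
  exact of_mem_s4Kernels l hy

/-- Members of an explicit slot die in the triple quotient. [folklore] -/
theorem mem_nc_iUnion_of_eq {l : Fin 3} {s : Set (SurfaceGroup 3)} (hl : K l = normalClosure s)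
    {y : SurfaceGroup 3} (hy : y ∈ s) :
    y ∈ normalClosure (⋃ i, (K i : Set (SurfaceGroup 3))) := by
  refine subset_normalClosure (Set.mem_iUnion.2 ⟨l, ?_⟩)
  rw [hl]
  exact subset_normalClosure hy

/-- Generators of a standard slot die in a pair quotient (left slot). [folklore] -/
theorem of_mem_nc_union_left {i j : Fin 3} (hi : K i = s4Kernels i) {y : surfaceGen 3}
    (hy : y ∈ s4Gens i) :
    (PresentedGroup.of y : SurfaceGroup 3) ∈
      normalClosure ((K i : Set (SurfaceGroup 3)) ∪ K j) := by
  refine subset_normalClosure (Or.inl ?_)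
  rw [hi]
  exact of_mem_s4Kernels i hy

/-- Members of an explicit slot die in a pair quotient (right slot). [folklore] -/
theorem mem_nc_union_right {i j : Fin 3} {s : Set (SurfaceGroup 3)} (hj : K j = normalClosure s)
    {y : SurfaceGroup 3} (hy : y ∈ s) :
    y ∈ normalClosure ((K i : Set (SurfaceGroup 3)) ∪ K j) := by
  refine subset_normalClosure (Or.inr ?_)
  rw [hj]
  exact subset_normalClosure hy

variable {K}

/-- `π₁ = 1` for `cpA`: every generator dies in the triple quotient. [folklore] -/
theorem subsingleton_tripleQuotient_cpA : Subsingleton cpA.tripleQuotient := by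
  refine subsingleton_quotient_of_forall_of_mem _ fun x => ?_
  obtain ⟨k, b⟩ := x
  fin_cases k <;> cases b
  · exact of_mem_nc_iUnion_of_eq cpA cpA_zero (l := 0) (by decide)
  · exact mem_nc_iUnion_of_eq cpA cpA_two (by simp [zb])
  · exact of_mem_nc_iUnion_of_eq cpA cpA_zero (l := 0) (by decide)
  · exact of_mem_nc_iUnion_of_eq cpA cpA_one (l := 1) (by decide)
  · exact of_mem_nc_iUnion_of_eq cpA cpA_one (l := 1) (by decide)
  · exact of_mem_nc_iUnion_of_eq cpA cpA_zero (l := 0) (by decide)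

/-- `π₁ = 1` for `cpB`. [folklore] -/
theorem subsingleton_tripleQuotient_cpB : Subsingleton cpB.tripleQuotient := by
  refine subsingleton_quotient_of_forall_of_mem _ fun x => ?_
  obtain ⟨k, b⟩ := x
  fin_cases k <;> cases b
  · exact of_mem_nc_iUnion_of_eq cpB cpB_zero (l := 0) (by decide)
  · exact mem_nc_iUnion_of_eq cpB cpB_two (by simp [zb])
  · exact of_mem_nc_iUnion_of_eq cpB cpB_zero (l := 0) (by decide)
  · exact of_mem_nc_iUnion_of_eq cpB cpB_one (l := 1) (by decide)
  · exact of_mem_nc_iUnion_of_eq cpB cpB_one (l := 1) (by decide)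
  · exact of_mem_nc_iUnion_of_eq cpB cpB_zero (l := 0) (by decide)

/-- `π₁ = 1` for `cpC`. [folklore] -/
theorem subsingleton_tripleQuotient_cpC : Subsingleton cpC.tripleQuotient := by
  refine subsingleton_quotient_of_forall_of_mem _ fun x => ?_
  obtain ⟨k, b⟩ := x
  fin_cases k <;> cases b
  · exact of_mem_nc_iUnion_of_eq cpC cpC_zero (l := 0) (by decide)
  · exact of_mem_nc_iUnion_of_eq cpC cpC_two (l := 2) (by decide)
  · exact of_mem_nc_iUnion_of_eq cpC cpC_zero (l := 0) (by decide)
  · exact mem_nc_iUnion_of_eq cpC cpC_one (by simp [zb])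
  · exact of_mem_nc_iUnion_of_eq cpC cpC_two (l := 2) (by decide)
  · exact of_mem_nc_iUnion_of_eq cpC cpC_zero (l := 0) (by decide)

/-- The `(1,2)` pair quotient of `cpA` is TRIVIAL (rank `0`, not `1`): `(N₁, T_{b₂}N₂)` is a
genus-3 splitting of `S³`, not of `S¹×S²`. [folklore] -/
theorem isFreeOfRank_pairQuotient_cpA : IsFreeOfRank (cpA.pairQuotient 1 2) 0 := by
  haveI : Subsingleton (cpA.pairQuotient 1 2) := by
    refine subsingleton_quotient_of_forall_of_mem _ fun x => ?_
    have hb2 : zb 2 ∈ normalClosure ((cpA 1 : Set (SurfaceGroup 3)) ∪ cpA 2) :=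
      mem_of_mul_mem_left (of_mem_nc_union_left cpA cpA_one (y := ((2 : Fin 3), false)) (by decide))
        (mem_nc_union_right cpA cpA_two (y := za 2 * zb 2) (by simp))
    obtain ⟨k, b⟩ := x
    fin_cases k <;> cases b
    · exact of_mem_nc_union_left cpA cpA_one (by decide)
    · exact mem_nc_union_right cpA cpA_two (by simp [zb])
    · exact mem_nc_union_right cpA cpA_two (by simp [za])
    · exact of_mem_nc_union_left cpA cpA_one (by decide)
    · exact of_mem_nc_union_left cpA cpA_one (by decide)
    · exact hb2
  exact isFreeOfRank_zero_of_subsingleton _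

/-- The `(0,2)` pair quotient of `cpB` is trivial. [folklore] -/
theorem isFreeOfRank_pairQuotient_cpB : IsFreeOfRank (cpB.pairQuotient 0 2) 0 := by
  haveI : Subsingleton (cpB.pairQuotient 0 2) := by
    refine subsingleton_quotient_of_forall_of_mem _ fun x => ?_
    have hb1 : zb 1 ∈ normalClosure ((cpB 0 : Set (SurfaceGroup 3)) ∪ cpB 2) :=
      mem_of_mul_mem_left (of_mem_nc_union_left cpB cpB_zero (y := ((1 : Fin 3), false)) (by decide))
        (mem_nc_union_right cpB cpB_two (y := za 1 * zb 1) (by simp))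
    obtain ⟨k, b⟩ := x
    fin_cases k <;> cases b
    · exact of_mem_nc_union_left cpB cpB_zero (by decide)
    · exact mem_nc_union_right cpB cpB_two (by simp [zb])
    · exact of_mem_nc_union_left cpB cpB_zero (by decide)
    · exact hb1
    · exact mem_nc_union_right cpB cpB_two (by simp [za])
    · exact of_mem_nc_union_left cpB cpB_zero (by decide)
  exact isFreeOfRank_zero_of_subsingleton _

/-- The `(0,1)` pair quotient of `cpC` is trivial. [folklore] -/
theorem isFreeOfRank_pairQuotient_cpC : IsFreeOfRank (cpC.pairQuotient 0 1) 0 := by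
  haveI : Subsingleton (cpC.pairQuotient 0 1) := by
    refine subsingleton_quotient_of_forall_of_mem _ fun x => ?_
    have hb0 : zb 0 ∈ normalClosure ((cpC 0 : Set (SurfaceGroup 3)) ∪ cpC 1) :=
      mem_of_mul_mem_left (of_mem_nc_union_left cpC cpC_zero (y := ((0 : Fin 3), false)) (by decide))
        (mem_nc_union_right cpC cpC_one (y := za 0 * zb 0) (by simp))
    obtain ⟨k, b⟩ := x
    fin_cases k <;> cases b
    · exact of_mem_nc_union_left cpC cpC_zero (by decide)
    · exact hb0
    · exact of_mem_nc_union_left cpC cpC_zero (by decide)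
    · exact mem_nc_union_right cpC cpC_one (by simp [zb])
    · exact mem_nc_union_right cpC cpC_one (by simp [za])
    · exact of_mem_nc_union_left cpC cpC_zero (by decide)
  exact isFreeOfRank_zero_of_subsingleton _

end ranks

/-- `cpA` is not stably trivial (pair rank `0 ≠ 1`). [folklore] -/
theorem not_isStablyTrivial_cpA : ¬ cpA.IsStablyTrivial :=
  not_isStablyTrivial_of_pairRank (m := 0) (by decide) isFreeOfRank_pairQuotient_cpA (by decide)

/-- `cpB` is not stably trivial. [folklore] -/
theorem not_isStablyTrivial_cpB : ¬ cpB.IsStablyTrivial :=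
  not_isStablyTrivial_of_pairRank (m := 0) (by decide) isFreeOfRank_pairQuotient_cpB (by decide)

/-- `cpC` is not stably trivial. [folklore] -/
theorem not_isStablyTrivial_cpC : ¬ cpC.IsStablyTrivial :=
  not_isStablyTrivial_of_pairRank (m := 0) (by decide) isFreeOfRank_pairQuotient_cpC (by decide)

/-! ### §6.4 The gate needs both sides; each pair condition is load-bearing in the triple form -/

/-- **GATE NEEDS BOTH SIDES (I).**  `(K₀,K₁) = (N₀,N₁)`, `π₁ = 1` and `K₂ ∈ Stab(N₀)·N₂` do NOT
give stable triviality: `K₂ = T_{b₂}N₂` (`ℂP²`). [folklore] -/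
theorem gate_false_without_gamma :
    ¬ ∀ (m : ℕ) (K : TrisectionKernels (3 + 3 * m)),
      K 0 = s4Kernels.stabilizeIter m 0 → K 1 = s4Kernels.stabilizeIter m 1 →
      Subsingleton K.tripleQuotient →
      (∃ β : SurfaceGroup (3 + 3 * m) ≃* SurfaceGroup (3 + 3 * m),
        (s4Kernels.stabilizeIter m 0).map β.toMonoidHom = s4Kernels.stabilizeIter m 0 ∧
        (s4Kernels.stabilizeIter m 2).map β.toMonoidHom = K 2) →
      K.IsStablyTrivial := by
  intro h
  have h0 := h 0
  rw [s4Kernels_stabilizeIter_zero] at h0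
  exact not_isStablyTrivial_cpA (h0 cpA cpA_zero cpA_one subsingleton_tripleQuotient_cpA
    ⟨(twB 2).toMulEquiv, map_twB2_s4Kernels_zero, map_twB2_s4Kernels_two.trans cpA_two.symm⟩)

/-- **GATE NEEDS BOTH SIDES (II).**  `(K₀,K₁) = (N₀,N₁)`, `π₁ = 1` and `K₂ ∈ Stab(N₁)·N₂` do NOT
give stable triviality: `K₂ = T_{b₁}N₂` (`ℂP²`). [folklore] -/
theorem gate_false_without_beta :
    ¬ ∀ (m : ℕ) (K : TrisectionKernels (3 + 3 * m)),
      K 0 = s4Kernels.stabilizeIter m 0 → K 1 = s4Kernels.stabilizeIter m 1 →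
      Subsingleton K.tripleQuotient →
      (∃ γ : SurfaceGroup (3 + 3 * m) ≃* SurfaceGroup (3 + 3 * m),
        (s4Kernels.stabilizeIter m 1).map γ.toMonoidHom = s4Kernels.stabilizeIter m 1 ∧
        (s4Kernels.stabilizeIter m 2).map γ.toMonoidHom = K 2) →
      K.IsStablyTrivial := by
  intro h
  have h0 := h 0
  rw [s4Kernels_stabilizeIter_zero] at h0
  exact not_isStablyTrivial_cpB (h0 cpB cpB_zero cpB_one subsingleton_tripleQuotient_cpB
    ⟨(twB 1).toMulEquiv, map_twB1_s4Kernels_one, map_twB1_s4Kernels_two.trans cpB_two.symm⟩)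

/-- **Each pair condition is load-bearing in the triple form (pair `(1,2)`).** [folklore] -/
theorem tripleForm_false_without_pair12 :
    ¬ ∀ (m : ℕ) (K : TrisectionKernels (3 + 3 * m)), Subsingleton K.tripleQuotient →
      (∃ α : SurfaceGroup (3 + 3 * m) ≃* SurfaceGroup (3 + 3 * m),
        (s4Kernels.stabilizeIter m 0).map α.toMonoidHom = K 0 ∧
        (s4Kernels.stabilizeIter m 1).map α.toMonoidHom = K 1) →
      (∃ α : SurfaceGroup (3 + 3 * m) ≃* SurfaceGroup (3 + 3 * m),
        (s4Kernels.stabilizeIter m 0).map α.toMonoidHom = K 0 ∧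
        (s4Kernels.stabilizeIter m 2).map α.toMonoidHom = K 2) →
      K.IsStablyTrivial := by
  intro h
  have h0 := h 0
  rw [s4Kernels_stabilizeIter_zero] at h0
  refine not_isStablyTrivial_cpA (h0 cpA subsingleton_tripleQuotient_cpA
    ⟨MulEquiv.refl _, ?_, ?_⟩
    ⟨(twB 2).toMulEquiv, map_twB2_s4Kernels_zero.trans cpA_zero.symm,
      map_twB2_s4Kernels_two.trans cpA_two.symm⟩)
  · simpa using cpA_zero.symm
  · simpa using cpA_one.symm

/-- **Each pair condition is load-bearing in the triple form (pair `(0,2)`).** [folklore] -/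
theorem tripleForm_false_without_pair02 :
    ¬ ∀ (m : ℕ) (K : TrisectionKernels (3 + 3 * m)), Subsingleton K.tripleQuotient →
      (∃ α : SurfaceGroup (3 + 3 * m) ≃* SurfaceGroup (3 + 3 * m),
        (s4Kernels.stabilizeIter m 0).map α.toMonoidHom = K 0 ∧
        (s4Kernels.stabilizeIter m 1).map α.toMonoidHom = K 1) →
      (∃ α : SurfaceGroup (3 + 3 * m) ≃* SurfaceGroup (3 + 3 * m),
        (s4Kernels.stabilizeIter m 1).map α.toMonoidHom = K 1 ∧
        (s4Kernels.stabilizeIter m 2).map α.toMonoidHom = K 2) →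
      K.IsStablyTrivial := by
  intro h
  have h0 := h 0
  rw [s4Kernels_stabilizeIter_zero] at h0
  refine not_isStablyTrivial_cpB (h0 cpB subsingleton_tripleQuotient_cpB
    ⟨MulEquiv.refl _, ?_, ?_⟩
    ⟨(twB 1).toMulEquiv, map_twB1_s4Kernels_one.trans cpB_one.symm,
      map_twB1_s4Kernels_two.trans cpB_two.symm⟩)
  · simpa using cpB_zero.symm
  · simpa using cpB_one.symm

/-- **Each pair condition is load-bearing in the triple form (pair `(0,1)`).** [folklore] -/
theorem tripleForm_false_without_pair01 :
    ¬ ∀ (m : ℕ) (K : TrisectionKernels (3 + 3 * m)), Subsingleton K.tripleQuotient →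
      (∃ α : SurfaceGroup (3 + 3 * m) ≃* SurfaceGroup (3 + 3 * m),
        (s4Kernels.stabilizeIter m 0).map α.toMonoidHom = K 0 ∧
        (s4Kernels.stabilizeIter m 2).map α.toMonoidHom = K 2) →
      (∃ α : SurfaceGroup (3 + 3 * m) ≃* SurfaceGroup (3 + 3 * m),
        (s4Kernels.stabilizeIter m 1).map α.toMonoidHom = K 1 ∧
        (s4Kernels.stabilizeIter m 2).map α.toMonoidHom = K 2) →
      K.IsStablyTrivial := by
  intro h
  have h0 := h 0
  rw [s4Kernels_stabilizeIter_zero] at h0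
  refine not_isStablyTrivial_cpC (h0 cpC subsingleton_tripleQuotient_cpC
    ⟨MulEquiv.refl _, ?_, ?_⟩
    ⟨(twB 0).toMulEquiv, map_twB0_s4Kernels_one.trans cpC_one.symm,
      map_twB0_s4Kernels_two.trans cpC_two.symm⟩)
  · simpa using cpC_zero.symm
  · simpa using cpC_two.symm


/-! ## §7 Level descent modulo Nielsen: the crux may be assumed only for large `m` -/

/-- `PairsStandard` ascends along one stabilisation, granted Nielsen: stabilise the pair
automorphism by `iso_stabilize_map_of_lift` (stabilisation is slot-wise). [folklore] -/
theorem pairsStandard_stabilize_of_nielsen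
    (hN : ∀ (G : ℕ) (α : SurfaceGroup G ≃* SurfaceGroup G),
      ∃ (φ : FreeGroup (surfaceGen G) ≃* FreeGroup (surfaceGen G)) (c : FreeGroup (surfaceGen G))
        (ε : ℤ), (ε = 1 ∨ ε = -1) ∧ φ (surfaceRelator G) = c * surfaceRelator G ^ ε * c⁻¹ ∧
        ∀ x, PresentedGroup.mk _ (φ x) = α (PresentedGroup.mk _ x))
    {K : TrisectionKernels (3 + 3 * m)} (h : PairsStandard m K) :
    PairsStandard (m + 1) K.stabilize := by
  intro i j hij
  obtain ⟨α, hi, hj⟩ := h i j hij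
  obtain ⟨α', hα'⟩ :=
    TrisectionKernels.iso_stabilize_map_of_lift (s4Kernels.stabilizeIter m) α (hN _ α)
  refine ⟨α', ?_, ?_⟩
  · show ((s4Kernels.stabilizeIter m).stabilize i).map α'.toMonoidHom = K.stabilize i
    rw [hα' i]
    simp only [TrisectionKernels.stabilize_apply, hi]
  · show ((s4Kernels.stabilizeIter m).stabilize j).map α'.toMonoidHom = K.stabilize j
    rw [hα' j]
    simp only [TrisectionKernels.stabilize_apply, hj]

/-- **LEVEL DESCENT modulo Nielsen.**  The crux at level `m + 1` implies the crux at level `m`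
(stabilise once: the hypotheses ascend — `stabilize_isGroupTrisection_holds` and
`pairsStandard_stabilize_of_nielsen` — and stable triviality descends,
`isStablyTrivial_of_stabilizeIter`).  So, granted Nielsen, the crux is equivalent to its EVENTUAL
form "for all `m ≥ m₀`" for any `m₀` (e.g. the asymptotic regime `g ≫ 0` of Dunfield–Thurston used
by the route's rung `ShadowsStandard`), and no refutation can come from small `m` alone unless it
persists stably. [folklore] -/
theorem level_down_of_nielsen
    (hN : ∀ (G : ℕ) (α : SurfaceGroup G ≃* SurfaceGroup G),
      ∃ (φ : FreeGroup (surfaceGen G) ≃* FreeGroup (surfaceGen G)) (c : FreeGroup (surfaceGen G))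
        (ε : ℤ), (ε = 1 ∨ ε = -1) ∧ φ (surfaceRelator G) = c * surfaceRelator G ^ ε * c⁻¹ ∧
        ∀ x, PresentedGroup.mk _ (φ x) = α (PresentedGroup.mk _ x))
    (h : ∀ K : TrisectionKernels (3 + 3 * (m + 1)),
      IsGroupTrisection (3 + 3 * (m + 1)) (m + 1 + 1) (PUnit : Type) K →
        PairsStandard (m + 1) K → K.IsStablyTrivial)
    (K : TrisectionKernels (3 + 3 * m)) (hK : IsGroupTrisection (3 + 3 * m) (m + 1) (PUnit : Type) K)
    (hP : PairsStandard m K) : K.IsStablyTrivial :=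
  isStablyTrivial_of_stabilizeIter K 1
    (h K.stabilize (stabilize_isGroupTrisection_holds _ _ _ _ hK)
      (pairsStandard_stabilize_of_nielsen hN hP))


/-- **Eventual form suffices modulo Nielsen** (work-file corollary; positive in the crux, not for
landing): if the crux holds at every level `m ≥ m₀` then it holds. [folklore] -/
theorem normalFormStablyTrivial_of_eventually_of_nielsen
    (hN : ∀ (G : ℕ) (α : SurfaceGroup G ≃* SurfaceGroup G),
      ∃ (φ : FreeGroup (surfaceGen G) ≃* FreeGroup (surfaceGen G)) (c : FreeGroup (surfaceGen G))
        (ε : ℤ), (ε = 1 ∨ ε = -1) ∧ φ (surfaceRelator G) = c * surfaceRelator G ^ ε * c⁻¹ ∧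
        ∀ x, PresentedGroup.mk _ (φ x) = α (PresentedGroup.mk _ x))
    (m₀ : ℕ)
    (h : ∀ m, m₀ ≤ m → ∀ K : TrisectionKernels (3 + 3 * m),
      IsGroupTrisection (3 + 3 * m) (m + 1) (PUnit : Type) K → PairsStandard m K → K.IsStablyTrivial) :
    NormalFormStablyTrivial := by
  -- descending induction on the distance to `m₀`
  have key : ∀ d m, m₀ ≤ m + d → ∀ K : TrisectionKernels (3 + 3 * m),
      IsGroupTrisection (3 + 3 * m) (m + 1) (PUnit : Type) K → PairsStandard m K → K.IsStablyTrivial := by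
    intro d
    induction d with
    | zero => intro m hm; exact h m (by omega)
    | succ d ih =>
      intro m hm K hK hP
      exact level_down_of_nielsen hN (ih (m + 1) (by omega)) K hK hP
  intro m K hK hP
  exact key m₀ m (by omega) K hK hP

end Summit.SmoothPoincare4.SmoothPoincare4.Cruxes.NormalFormStablyTrivial.Disproof

end
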